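import Literature.NumberTheory.PAdicHodge.TateTwistInvariants
import HarnessLib

/-!
# Tate's theorem `H⁰(Gal(F̄/M), ℂ_F(χ^j)) = 0` (`j ≠ 0`) for a finite extension `M` of `F` inside `F̄`

Continuation of `TateTwistInvariants` (the case `M = F`). Let `F` be a non-archimedean local field of
characteristic `0` and residue characteristic `p`, `K₀ = PadicBase F p hp ≅ ℚ_p`,
`F̄ = NormedAlgClosure F`, `ℂ_F = CompletedAlgClosure F`, `G₀ = Gal(F̄/K₀)`, and let `F ⊆ M ⊆ F̄` be an
intermediate field which is FINITE over `F`.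

**Theorem** (`CompletedAlgClosure.eq_zero_of_forall_fixing_smul_eq_cyclotomicCharacter_zpow`). If
`x ∈ ℂ_F` satisfies `σ • x = χ_F(σ)^j · x` for every `σ ∈ Γ_F` fixing `M` pointwise (`j ∈ ℤ ∖ {0}`, the
scalar through `ℤ_p ⊆ ℚ_p → F → ℂ_F`), then `x = 0`: `ℂ_F(χ^{-j})^{Gal(F̄/M)} = 0`.  This is Tate 1967,
§3.3, Theorem 2 (the `H⁰` half) for the `p`-adic field `M`, stated INSIDE `ℂ_F` for the closed subgroup
`Gal(F̄/M) ≤ Γ_F` — the form needed when Tate's theory of Hodge–Tate characters over a base of degree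
`> 1` is run in the single field `ℂ_F` (with the relative Ax–Sen–Tate theorem `AxSenTateRelative` and the
named fact `LubinTateCharacterConjugateAdmissible`), e.g. for the normal closure `M` of `F` and of a
coefficient field.

The proof is the multiplicative transfer of `TateDescent` VERBATIM with `F` replaced by `M`: choose for
each `K₀`-embedding `φ : M → F̄` an extension `s_φ ∈ G₀` (`liftEmb`, Mathlib `AlgHom.liftNormal`); for
`g ∈ G₀`, `g s_φ = s_{gφ} h_φ` with `h_φ` fixing `M` pointwise (`corr_smul_coe`); then `y = ∏_φ s_φ • x`
satisfies `g • y = χ(g)^{dj} y` for all `g ∈ G₀`, `d = [M : K₀]`, so `y = 0` by the theorem over the base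
(`TateTrace.eq_zero_of_forall_base_smul_eq`), hence some `s_φ • x = 0`, hence `x = 0`.

## References
* J. Tate, *p-divisible groups* (1967), §3.3, Theorem 2. [Tate1967]
* J.-M. Fontaine, Y. Ouyang, *Theory of p-adic Galois representations*, §3.2. [FontaineOuyang2022]
* J.-P. Serre, *Abelian ℓ-adic representations and elliptic curves* (1968), Ch. III App. A.1–A.2
  (`H⁰(G_K, ℂ(χ)) = 0` used over every finite `K/ℚ_p`). [SerreAbelianLadic1968]
-/

noncomputable section

open ValuativeRel Field UniformSpace Finset

namespace Literature.NumberTheory.PAdicHodge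

open Literature.NumberTheory.GaloisRepresentations
open Literature.NumberTheory.GaloisRepresentations.IsNonarchimedeanLocalField
open CyclotomicTower

variable {F : Type} [Field F] [ValuativeRel F] [TopologicalSpace F] [IsNonarchimedeanLocalField F]
  [CharZero F] {p : ℕ} [Fact p.Prime] (hp : valuation F p < 1)
  (M : IntermediateField F (NormedAlgClosure F))

namespace TateDescentRel

/-! ### `K₀`-embeddings of `M` and coset representatives of `Gal(F̄/M)` in `G₀` -/

/-- The (finite) type of `K₀`-embeddings `M → F̄`. [folklore] -/
abbrev Emb : Type := M →ₐ[PadicBase F p hp] NormedAlgClosure F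

/-- `K₀ → M → F̄` is a scalar tower (the `K₀`-structure of `M ⊆ F̄` is the restriction of that of `F̄`).
[folklore] -/
instance instIsScalarTower : IsScalarTower (PadicBase F p hp) M (NormedAlgClosure F) :=
  IsScalarTower.of_algebraMap_eq fun _ => rfl

/-- `M/K₀` is finite-dimensional when `M/F` is (`F/K₀` is). [folklore] -/
instance instFiniteDimensional [FiniteDimensional F M] : FiniteDimensional (PadicBase F p hp) M :=
  FiniteDimensional.trans (PadicBase F p hp) F M

/-- `Emb` is finite when `M/F` is. [folklore] -/
instance instFintypeEmb [FiniteDimensional F M] : Fintype (Emb hp M) :=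
  minpoly.AlgHom.fintype (PadicBase F p hp) M (NormedAlgClosure F)

/-- The inclusion `M ⊆ F̄` as a `K₀`-embedding. [folklore] -/
def emb₀ : Emb hp M := IsScalarTower.toAlgHom (PadicBase F p hp) M (NormedAlgClosure F)

/-- `Emb` is nonempty. [folklore] -/
instance instNonemptyEmb : Nonempty (Emb hp M) := ⟨emb₀ hp M⟩

/-- **An extension `s_φ ∈ G₀` of the embedding `φ : M → F̄`** (`F̄/K₀` normal algebraic). [folklore] -/
def liftEmb (φ : Emb hp M) : BaseGaloisGroup hp :=
  AlgEquiv.ofBijective (φ.liftNormal (NormedAlgClosure F))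
    (Algebra.IsAlgebraic.algHom_bijective _)

/-- `s_φ` extends `φ`. [folklore] -/
private theorem liftEmb_coe (φ : Emb hp M) (y : M) :
    liftEmb hp M φ (y : NormedAlgClosure F) = φ y := by
  change φ.liftNormal (NormedAlgClosure F) (algebraMap M (NormedAlgClosure F) y) = φ y
  rw [AlgHom.liftNormal_commutes]
  rfl

/-- The permutation `φ ↦ g ∘ φ` of `Emb` by `g ∈ G₀`. [folklore] -/
def permEmb (g : BaseGaloisGroup hp) : Emb hp M ≃ Emb hp M where
  toFun φ := (g : NormedAlgClosure F →ₐ[PadicBase F p hp] NormedAlgClosure F).comp φ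
  invFun φ := ((g⁻¹ : BaseGaloisGroup hp) : NormedAlgClosure F →ₐ[PadicBase F p hp] NormedAlgClosure F).comp φ
  left_inv φ := by
    ext c
    change g⁻¹ (g (φ c)) = φ c
    rw [AlgEquiv.aut_inv, AlgEquiv.symm_apply_apply]
  right_inv φ := by
    ext c
    change g (g⁻¹ (φ c)) = φ c
    rw [AlgEquiv.aut_inv, AlgEquiv.apply_symm_apply]

/-- Unfolding of `permEmb`. [folklore] -/
private theorem permEmb_apply (g : BaseGaloisGroup hp) (φ : Emb hp M) (c : M) :
    permEmb hp M g φ c = g (φ c) := rfl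

/-- **The correction `h_φ = s_{gφ}⁻¹ g s_φ`.** [folklore] -/
def corr (g : BaseGaloisGroup hp) (φ : Emb hp M) : BaseGaloisGroup hp :=
  (liftEmb hp M (permEmb hp M g φ))⁻¹ * g * liftEmb hp M φ

/-- `g s_φ = s_{gφ} h_φ`. [folklore] -/
private theorem mul_liftEmb (g : BaseGaloisGroup hp) (φ : Emb hp M) :
    g * liftEmb hp M φ = liftEmb hp M (permEmb hp M g φ) * corr hp M g φ := by
  rw [corr, ← mul_assoc, ← mul_assoc, mul_inv_cancel, one_mul]

/-- **`h_φ` fixes `M` pointwise.** [folklore] -/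
private theorem corr_smul_coe (g : BaseGaloisGroup hp) (φ : Emb hp M) (y : M) :
    corr hp M g φ • (y : NormedAlgClosure F) = y := by
  rw [corr, mul_smul, mul_smul, BaseGaloisGroup.smul_def, BaseGaloisGroup.smul_def,
    BaseGaloisGroup.smul_def, liftEmb_coe, AlgEquiv.aut_inv, AlgEquiv.symm_apply_eq,
    liftEmb_coe, permEmb_apply]

/-! ### The norm `y = ∏_φ s_φ • x` and its transformation law -/

/-- **Transformation of the norm.** If `h • x = ι(χ(h))^j x` for all `h ∈ G₀` fixing `M` pointwise,
then `y = ∏_φ s_φ • x` satisfies `g • y = ι(χ(g))^{dj} y` for all `g ∈ G₀`, `d = #Emb = [M : K₀]`.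
[cite: Tate1967, §3.3] -/
theorem smul_norm_eq [FiniteDimensional F M] {j : ℤ} {x : CompletedAlgClosure F}
    (hx : ∀ h : BaseGaloisGroup hp, (∀ y : M, h • (y : NormedAlgClosure F) = y) →
      h • x = TateTrace.ι hp (TateDescent.W hp h) ^ j * x)
    (g : BaseGaloisGroup hp) :
    g • (∏ φ : Emb hp M, liftEmb hp M φ • x) =
      TateTrace.ι hp (TateDescent.W hp g) ^ ((Fintype.card (Emb hp M) : ℤ) * j) *
        ∏ φ : Emb hp M, liftEmb hp M φ • x := by
  classical
  have hfac : ∀ φ : Emb hp M, g • (liftEmb hp M φ • x) =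
      TateTrace.ι hp (TateDescent.W hp (corr hp M g φ) ^ j) * (liftEmb hp M (permEmb hp M g φ) • x) := by
    intro φ
    have hcorr : corr hp M g φ • x = TateTrace.ι hp (TateDescent.W hp (corr hp M g φ) ^ j) * x := by
      rw [hx _ (corr_smul_coe hp M g φ), TateTrace.ι_zpow]
    rw [← mul_smul, mul_liftEmb, mul_smul, hcorr, smul_mul', TateTrace.base_smul_ι]
  have hprod : g • (∏ φ : Emb hp M, liftEmb hp M φ • x) = ∏ φ : Emb hp M, g • (liftEmb hp M φ • x) :=
    map_prod (MulSemiringAction.toRingHom (BaseGaloisGroup hp) (CompletedAlgClosure F) g) _ _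
  rw [hprod, Finset.prod_congr rfl fun φ _ => hfac φ, Finset.prod_mul_distrib,
    Equiv.prod_comp (permEmb hp M g) (fun φ => liftEmb hp M φ • x)]
  congr 1
  have hW : ∀ φ : Emb hp M, TateDescent.W hp (corr hp M g φ) =
      (TateDescent.W hp (liftEmb hp M (permEmb hp M g φ)))⁻¹ *
        (TateDescent.W hp g * TateDescent.W hp (liftEmb hp M φ)) := by
    intro φ
    rw [corr, map_mul, map_mul, map_inv, mul_assoc]
  have hP : ∏ φ : Emb hp M, TateDescent.W hp (liftEmb hp M φ) ≠ 0 :=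
    Finset.prod_ne_zero_iff.mpr fun φ _ => TateDescent.W_ne_zero hp _
  have hWprod : ∏ φ : Emb hp M, TateDescent.W hp (corr hp M g φ) =
      TateDescent.W hp g ^ Fintype.card (Emb hp M) := by
    rw [Finset.prod_congr rfl fun φ _ => hW φ, Finset.prod_mul_distrib, Finset.prod_mul_distrib,
      Finset.prod_inv_distrib, Finset.prod_const, Finset.card_univ,
      Equiv.prod_comp (permEmb hp M g) (fun φ => TateDescent.W hp (liftEmb hp M φ))]
    field_simp
  have h1 : ∏ φ : Emb hp M, TateTrace.ι hp (TateDescent.W hp (corr hp M g φ) ^ j) =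
      TateTrace.ι hp (∏ φ : Emb hp M, TateDescent.W hp (corr hp M g φ) ^ j) := by
    simp only [← TateTrace.ιHom_apply]; exact (map_prod (TateTrace.ιHom hp) _ _).symm
  rw [h1, Finset.prod_zpow, hWprod, TateTrace.ι_zpow, ← TateTrace.ιHom_apply, map_pow,
    TateTrace.ιHom_apply, zpow_mul, zpow_natCast]

/-- **Descent to `Gal(F̄/M)`** (phrased in `G₀`): for `j ≠ 0`, if `h • x = ι(χ(h))^j x` for all `h ∈ G₀`
fixing `M` pointwise, then `x = 0`. [cite: Tate1967, §3.3 Theorem 2] -/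
theorem eq_zero_of_forall_fixing_smul_eq [FiniteDimensional F M] {j : ℤ} (hj : j ≠ 0) {x : CompletedAlgClosure F}
    (hx : ∀ h : BaseGaloisGroup hp, (∀ y : M, h • (y : NormedAlgClosure F) = y) →
      h • x = TateTrace.ι hp (TateDescent.W hp h) ^ j * x) : x = 0 := by
  classical
  set y : CompletedAlgClosure F := ∏ φ : Emb hp M, liftEmb hp M φ • x with hy
  have hd : (Fintype.card (Emb hp M) : ℤ) * j ≠ 0 :=
    mul_ne_zero (Nat.cast_ne_zero.mpr Fintype.card_ne_zero) hj
  have key : ∀ g : BaseGaloisGroup hp, g • y =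
      TateTrace.ι hp (PadicBase.ofPadicInt hp (BaseGaloisGroup.baseCyclotomicCharacter hp g : ℤ_[p])) ^
        ((Fintype.card (Emb hp M) : ℤ) * j) * y :=
    fun g => smul_norm_eq hp M hx g
  have hy0 : y = 0 := TateTrace.eq_zero_of_forall_base_smul_eq hp hd key
  obtain ⟨φ, -, hφ⟩ := Finset.prod_eq_zero_iff.mp hy0
  exact (smul_eq_zero_iff_eq (liftEmb hp M φ)).mp hφ

end TateDescentRel

/-! ### The theorem for `Gal(F̄/M) ≤ Γ_F` -/

namespace CompletedAlgClosure

variable [FiniteDimensional F M]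

/-- **Tate's theorem `H⁰(Gal(F̄/M), ℂ_F(χ^{-j})) = 0` (`j ≠ 0`, `M/F` finite inside `F̄`).** Let
`χ_F = GaloisRep.cyclotomicCharacter F p` and let `x ∈ ℂ_F` satisfy `σ • x = χ_F(σ)^j · x` for every
`σ ∈ Γ_F` which fixes the intermediate field `M` (finite over `F`) pointwise, the scalar being the image of
`χ_F(σ)^j ∈ ℤ_p` under `ℤ_p ⊆ ℚ_p → F → ℂ_F`. Then `x = 0` (Tate 1967, §3.3, Theorem 2 for the `p`-adic
field `M`, inside `ℂ_F = ℂ_M`). [cite: Tate1967, §3.3 Theorem 2] [cite: FontaineOuyang2022, §3.2] -/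
theorem eq_zero_of_forall_fixing_smul_eq_cyclotomicCharacter_zpow {j : ℤ} (hj : j ≠ 0)
    {x : CompletedAlgClosure F}
    (hx : ∀ σ : absoluteGaloisGroup F, (∀ y ∈ M, σ • y = y) → σ • x =
      (algebraMap F (CompletedAlgClosure F)
        (LocalField.padicRingHom F p hp
          (((GaloisRep.cyclotomicCharacter F p σ : ℤ_[p]ˣ) : ℤ_[p]) : ℚ_[p]))) ^ j * x) :
    x = 0 := by
  refine TateDescentRel.eq_zero_of_forall_fixing_smul_eq hp M hj (x := x) fun h hh => ?_
  have hF : ∀ c : F, h • algebraMap F (NormedAlgClosure F) c = algebraMap F (NormedAlgClosure F) c :=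
    fun c => hh (algebraMap F M c)
  obtain ⟨σ, rfl⟩ := BaseGaloisGroup.exists_toBase_eq hp h hF
  have hσ : ∀ y ∈ M, σ • y = y := by
    intro y hy
    have := hh ⟨y, hy⟩
    rwa [BaseGaloisGroup.toBase_smul] at this
  rw [toBase_smul_completion, hx σ hσ, TateDescent.W_apply,
    BaseGaloisGroup.baseCyclotomicCharacter_toBase]
  rfl

/-- The same with `j ∈ ℕ`, `j ≠ 0`. [cite: Tate1967, §3.3 Theorem 2] -/
theorem eq_zero_of_forall_fixing_smul_eq_cyclotomicCharacter_pow {j : ℕ} (hj : j ≠ 0)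
    {x : CompletedAlgClosure F}
    (hx : ∀ σ : absoluteGaloisGroup F, (∀ y ∈ M, σ • y = y) → σ • x =
      (algebraMap F (CompletedAlgClosure F)
        (LocalField.padicRingHom F p hp
          (((GaloisRep.cyclotomicCharacter F p σ : ℤ_[p]ˣ) : ℤ_[p]) : ℚ_[p]))) ^ j * x) :
    x = 0 :=
  eq_zero_of_forall_fixing_smul_eq_cyclotomicCharacter_zpow hp M (j := (j : ℤ))
    (Int.natCast_ne_zero.mpr hj) (fun σ hσ => by rw [zpow_natCast]; exact hx σ hσ)

/-- **`H⁰(Gal(F̄/M), ℂ_F(χ^j))` as a set** is `{0}` for `j ≠ 0`. [cite: Tate1967, §3.3 Theorem 2] -/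
theorem fixingTwistInvariants_eq_singleton_zero {j : ℤ} (hj : j ≠ 0) :
    {x : CompletedAlgClosure F | ∀ σ : absoluteGaloisGroup F, (∀ y ∈ M, σ • y = y) → σ • x =
      (algebraMap F (CompletedAlgClosure F)
        (LocalField.padicRingHom F p hp
          (((GaloisRep.cyclotomicCharacter F p σ : ℤ_[p]ˣ) : ℤ_[p]) : ℚ_[p]))) ^ j * x} = {0} := by
  ext x
  simp only [Set.mem_setOf_eq, Set.mem_singleton_iff]
  constructor
  · exact eq_zero_of_forall_fixing_smul_eq_cyclotomicCharacter_zpow hp M hj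
  · rintro rfl σ _; rw [smul_zero, mul_zero]

end CompletedAlgClosure

end Literature.NumberTheory.PAdicHodge

end
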